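import Literature.NumberTheory.GelbartRogawski1991.LocalUnitaryGaloisConjCoinvariants
import Literature.RepresentationTheory.TwistedCoinvariantsTwoTransports
import Literature.NumberTheory.GelbartRogawski1991.LocalGaloisConjRankTwoCoinvariants
import HarnessLib

/-!
# Rank two, non-split place: `Θ_{ξ∘bar₁}(λᶜ-data, line −a) ≅ (ξ ∘ det⁻¹) ⊗ Θ_ξ(λ-data, line (det T₀)⁻¹·a)` — the combination (C4)-core

Topic `NumberTheory/GelbartRogawski1991`; namespace `Literature.NumberTheory.GelbartRogawski1991.UnitaryDualPair.LocalSplitting`.  KERNEL ONLY: theorems; no definition,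
no named fact, no `sorry`.  Cell `hodgecm-mathlib` (D-0151), programme P5 (crux HLiu418 = stmt-HodgeConjecture-24832), piece **(C4)-core** of the road card
`F0/P5/A-p18/g23/ROAD-L4if-v3.A-p18g23.md` §6 (A-p18 (g23), 2026-09-01): ★ (C1)-rep `exists_coinv_equiv_localPiGalConj` + (C2)-rep (the central determinant twist,
★ `localPiGalConj_eq_localCenter_mul_localCongr`) + ★ (C3)-rep `exists_coinv_equiv_localCongr_k` at `k₀ = (wT₀)⁻¹`, `m₀ = (det T₀)⁻¹`, composed by ★
`TwistedCoinv.exists_equiv_of_two_transports`.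

For a CM field `L`, a diagonal invertible `T₀ ∈ M₂(L⁺)`, `T₀′ = −T₀`, `T₀″ = (det T₀)⁻¹ T₀`, a non-split `v`, splitting Hecke characters `χ, χ′` with
`(χ′_w)⁻¹ = (χ_w)⁻¹∘σ_w`, the centre `Z = U(J₁)(L⁺_v)` and any character `ξ` of `Z`:
**`∃ E : (ω ∘ scaleT_{−1} s_{χ′}^{T₀′})_{Z, ξ∘bar₁} ≃ (ω ∘ scaleT_{(det T₀)⁻¹} s_χ^{T₀″})_{Z, ξ}`,  `E ∘ rep(g) = ξ((det g)⁻¹·1) • rep(g) ∘ E`**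
(`exists_coinv_equiv_galConj_similitude`).  With the companion det-twist B2 and Liu's class bookkeeping this is [Liu2021, Lem. D.1 (4)] «if» at a non-split place.
Nothing of the cited sources is asserted; HC_CM is proved only modulo the printed citations until rung 0 closes.

## References
* [Liu2021] Y. Liu, App. D §D.1 Step 3 (l. 5221), Lemma D.1 (4) (l. 5235).
* [MoeglinVignerasWaldspurger1987] LNM 1291 (1987), Chap. 1 I.17, Chap. 2 II.2, Chap. 3 IV.
* [GelbartRogawski1991] S. Gelbart, J. Rogawski, Invent. Math. 105 (1991), §3.1 Remark p. 457 L4–13.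
-/

set_option autoImplicit false
set_option Elab.async false

noncomputable section

open scoped Matrix
open NumberField IsDedekindDomain MeasureTheory Matrix
open Literature.RepresentationTheory.HeisenbergGroup
open Literature.NumberTheory.Automorphic Literature.NumberTheory.Automorphic.UnitaryGroup Literature.NumberTheory.Weil1964
open Literature.NumberTheory.GaloisRepresentations Literature.RepresentationTheory.HarrisKudlaSweet1996
open Literature.RepresentationTheory.TwistedCoinv

namespace Literature.NumberTheory.GelbartRogawski1991.UnitaryDualPair.LocalSplitting

variable (L : Type) [Field L] [NumberField L] [IsCMField L] (v : HeightOneSpectrum (𝓞 (maximalRealSubfield L)))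
  [MeasurableSpace (v.adicCompletion (maximalRealSubfield L))] [BorelSpace (v.adicCompletion (maximalRealSubfield L))]
  (μ : Measure (v.adicCompletion (maximalRealSubfield L))) [μ.IsAddHaarMeasure]
  {T₀ T₀' T₀'' : Matrix (Fin 2) (Fin 2) (maximalRealSubfield L)} {J₀ J₀' J₀'' : Matrix (Fin 2) (Fin 2) L}
  {T₁ : Matrix (Fin 1) (Fin 1) (maximalRealSubfield L)} {J₁ : Matrix (Fin 1) (Fin 1) L} (hT₁ : IsUnit T₁.det)
  (hJ₁ : J₁ = T₁.map (algebraMap (maximalRealSubfield L) L)) (hJ₁0 : J₁ 0 0 ≠ 0)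

include hT₁ hJ₁ in
set_option synthInstance.maxHeartbeats 400000 in
set_option maxHeartbeats 4000000 in
/-- **(C4)-core: `Θ_{ξ∘bar₁}(λᶜ-data, line −a) ≅ (ξ ∘ det⁻¹) ⊗ Θ_ξ(λ-data, line (det T₀)⁻¹·a)`** (rank 2, non-split `v`).
[cite: Liu2021, App. D Lemma D.1 (4) (l. 5235), §D.1 Step 3 (l. 5221)] [cite: MoeglinVignerasWaldspurger1987, Chap. 1 I.17, Chap. 2 II.2]
[cite: GelbartRogawski1991, §3.1 Remark p. 457 L4–13] -/
theorem exists_coinv_equiv_galConj_similitude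
    (t : Fin 2 → maximalRealSubfield L) (hT₀t : T₀ = Matrix.diagonal t) (hT₀ : T₀.IsSymm) (hT₀d : IsUnit T₀.det) (hTd : T₀.det ≠ 0)
    (hT₀' : T₀'.IsSymm) (hT₀'d : IsUnit T₀'.det) (hTT₀' : T₀' = ((-1 : (maximalRealSubfield L)ˣ) : maximalRealSubfield L) • T₀)
    (hT₀'' : T₀''.IsSymm) (hT₀''d : IsUnit T₀''.det) (hTT₀'' : T₀'' = (((Units.mk0 T₀.det hTd)⁻¹ : (maximalRealSubfield L)ˣ) : maximalRealSubfield L) • T₀)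
    (hJ₀ : J₀ = T₀.map (algebraMap (maximalRealSubfield L) L)) (hJ₀' : J₀' = T₀'.map (algebraMap (maximalRealSubfield L) L))
    (hJ₀'' : J₀'' = T₀''.map (algebraMap (maximalRealSubfield L) L))
    (hns : ∀ w : PlacesOver L v, IsCMField.complexConj L • w.1 = w.1)
    (χ χ' : HeckeCharacter L) (hχ : IsSplittingChar L 1 χ) (hχ' : IsSplittingChar L 1 χ')
    (hχχ' : ∀ (w : PlacesOver L v),
      (χ'.localComponent w.1)⁻¹ = (χ.localComponent w.1)⁻¹.comp
        (Units.map (galAdicCompletionMap (L := L) (IsCMField.complexConj L) (hns w) : w.1.adicCompletion L →* w.1.adicCompletion L)))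
    (m : LocalMp (maximalRealSubfield L) (2 + 2) (gramD (maximalRealSubfield L) 2 T₀) v)
    (hm : (deltaLagrangian (maximalRealSubfield L) v 2).map (toLin (maximalRealSubfield L) v (MpPsi.proj _ m)) =
      lagrangianY (maximalRealSubfield L) (2 + 2) v)
    (ξ : UnitaryGroup.localPi L (IsCMField.complexConj L) 1 J₁ v →* ℂˣ) :
    ∃ E : Coinv (((MpPsi.toRep (localSchrodinger (maximalRealSubfield L) 2 T₀ v)).comp
            (scaleTransportSection (maximalRealSubfield L) L (IsCMField.complexConj L) 2 (complexConj_imagUnit L) (imagUnit_ne_zero L)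
              (imagUnit_mul_self L) T₀ T₀' hT₀ hT₀' (-1) hTT₀' hJ₀ hJ₀' v (localSplittingCMWith L 2 hT₀' hT₀'d hJ₀' χ' hχ' v μ)
              (proj_localSplittingCMWith L 2 hT₀' hT₀'d hJ₀' χ' hχ' v μ))).comp (localCenter L (IsCMField.complexConj L) 2 J₀ J₁ hJ₁0 v)) (ξ.comp (localPiGalConj L (IsCMField.complexConj L) 1 v hJ₁)) ≃ₗ[ℂ] Coinv (((MpPsi.toRep (localSchrodinger (maximalRealSubfield L) 2 T₀ v)).comp
            (scaleTransportSection (maximalRealSubfield L) L (IsCMField.complexConj L) 2 (complexConj_imagUnit L) (imagUnit_ne_zero L)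
              (imagUnit_mul_self L) T₀ T₀'' hT₀ hT₀'' (Units.mk0 T₀.det hTd)⁻¹ hTT₀'' hJ₀ hJ₀'' v (localSplittingCMWith L 2 hT₀'' hT₀''d hJ₀'' χ hχ v μ)
              (proj_localSplittingCMWith L 2 hT₀'' hT₀''d hJ₀'' χ hχ v μ))).comp (localCenter L (IsCMField.complexConj L) 2 J₀ J₁ hJ₁0 v)) ξ,
      ∀ (g : UnitaryGroup.localPi L (IsCMField.complexConj L) 2 J₀ v) (x : Coinv (((MpPsi.toRep (localSchrodinger (maximalRealSubfield L) 2 T₀ v)).comp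
            (scaleTransportSection (maximalRealSubfield L) L (IsCMField.complexConj L) 2 (complexConj_imagUnit L) (imagUnit_ne_zero L)
              (imagUnit_mul_self L) T₀ T₀' hT₀ hT₀' (-1) hTT₀' hJ₀ hJ₀' v (localSplittingCMWith L 2 hT₀' hT₀'d hJ₀' χ' hχ' v μ)
              (proj_localSplittingCMWith L 2 hT₀' hT₀'d hJ₀' χ' hχ' v μ))).comp (localCenter L (IsCMField.complexConj L) 2 J₀ J₁ hJ₁0 v)) (ξ.comp (localPiGalConj L (IsCMField.complexConj L) 1 v hJ₁))),
        E (rep (ξ.comp (localPiGalConj L (IsCMField.complexConj L) 1 v hJ₁)) ((MpPsi.toRep (localSchrodinger (maximalRealSubfield L) 2 T₀ v)).comp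
            (scaleTransportSection (maximalRealSubfield L) L (IsCMField.complexConj L) 2 (complexConj_imagUnit L) (imagUnit_ne_zero L)
              (imagUnit_mul_self L) T₀ T₀' hT₀ hT₀' (-1) hTT₀' hJ₀ hJ₀' v (localSplittingCMWith L 2 hT₀' hT₀'d hJ₀' χ' hχ' v μ)
              (proj_localSplittingCMWith L 2 hT₀' hT₀'d hJ₀' χ' hχ' v μ))) (commute_comp_localCenter' hJ₁0 ((MpPsi.toRep (localSchrodinger (maximalRealSubfield L) 2 T₀ v)).comp
            (scaleTransportSection (maximalRealSubfield L) L (IsCMField.complexConj L) 2 (complexConj_imagUnit L) (imagUnit_ne_zero L)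
              (imagUnit_mul_self L) T₀ T₀' hT₀ hT₀' (-1) hTT₀' hJ₀ hJ₀' v (localSplittingCMWith L 2 hT₀' hT₀'d hJ₀' χ' hχ' v μ)
              (proj_localSplittingCMWith L 2 hT₀' hT₀'d hJ₀' χ' hχ' v μ)))) g x) =
          (((ξ (localUnitScalar L (IsCMField.complexConj L) J₁ v _ (inv_det_mul_conjLocal_inv_det L (IsCMField.complexConj L) hJ₀ v (complexConj_imagUnit L) (imagUnit_ne_zero L) hTd g)) : ℂˣ) : ℂ)) •
            rep ξ ((MpPsi.toRep (localSchrodinger (maximalRealSubfield L) 2 T₀ v)).comp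
            (scaleTransportSection (maximalRealSubfield L) L (IsCMField.complexConj L) 2 (complexConj_imagUnit L) (imagUnit_ne_zero L)
              (imagUnit_mul_self L) T₀ T₀'' hT₀ hT₀'' (Units.mk0 T₀.det hTd)⁻¹ hTT₀'' hJ₀ hJ₀'' v (localSplittingCMWith L 2 hT₀'' hT₀''d hJ₀'' χ hχ v μ)
              (proj_localSplittingCMWith L 2 hT₀'' hT₀''d hJ₀'' χ hχ v μ))) (commute_comp_localCenter' hJ₁0 ((MpPsi.toRep (localSchrodinger (maximalRealSubfield L) 2 T₀ v)).comp
            (scaleTransportSection (maximalRealSubfield L) L (IsCMField.complexConj L) 2 (complexConj_imagUnit L) (imagUnit_ne_zero L)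
              (imagUnit_mul_self L) T₀ T₀'' hT₀ hT₀'' (Units.mk0 T₀.det hTd)⁻¹ hTT₀'' hJ₀ hJ₀'' v (localSplittingCMWith L 2 hT₀'' hT₀''d hJ₀'' χ hχ v μ)
              (proj_localSplittingCMWith L 2 hT₀'' hT₀''d hJ₀'' χ hχ v μ)))) g (E x) := by
  -- the rational similitude `k₀ = (wT₀)⁻¹`, `m₀ = (det T₀)⁻¹` (★ (C2))
  have hk₀ : (((Matrix.GeneralLinearGroup.mkOfDetNeZero _ (det_w_mul_ne_zero hTd))⁻¹ : GL (Fin 2) (maximalRealSubfield L)) :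
        Matrix (Fin 2) (Fin 2) (maximalRealSubfield L))ᵀ * T₀ *
      (((Matrix.GeneralLinearGroup.mkOfDetNeZero _ (det_w_mul_ne_zero hTd))⁻¹ : GL (Fin 2) (maximalRealSubfield L)) : Matrix (Fin 2) (Fin 2) (maximalRealSubfield L)) =
      (((Units.mk0 T₀.det hTd)⁻¹ : (maximalRealSubfield L)ˣ) : maximalRealSubfield L) • T₀ := by
    rw [transpose_inv_w_mul_mul_mul_inv_w_mul hT₀ hTd, Units.val_inv_eq_inv_val, Units.val_mk0]
  have hkJ : formCongr ((IsCMField.complexConj L : L ≃ₐ[maximalRealSubfield L] L) : L →+* L) (Matrix.GeneralLinearGroup.map (algebraMap (maximalRealSubfield L) L) (Matrix.GeneralLinearGroup.mkOfDetNeZero _ (det_w_mul_ne_zero hTd))⁻¹)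
      (((algebraMap (maximalRealSubfield L) L) (((Units.mk0 T₀.det hTd)⁻¹ : (maximalRealSubfield L)ˣ) : maximalRealSubfield L))⁻¹ • J₀) = J₀ := by
    rw [Units.val_inv_eq_inv_val, Units.val_mk0, map_inv₀, inv_inv, ← det_form_eq hJ₀]
    exact formCongr_inv_w_mul (IsCMField.complexConj L) hT₀ hJ₀ hTd
  exact exists_equiv_of_two_transports_of_exists ((MpPsi.toRep (localSchrodinger (maximalRealSubfield L) 2 T₀ v)).comp (localSplittingCMWith L 2 hT₀ hT₀d hJ₀ χ hχ v μ)) ((MpPsi.toRep (localSchrodinger (maximalRealSubfield L) 2 T₀ v)).comp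
            (scaleTransportSection (maximalRealSubfield L) L (IsCMField.complexConj L) 2 (complexConj_imagUnit L) (imagUnit_ne_zero L)
              (imagUnit_mul_self L) T₀ T₀' hT₀ hT₀' (-1) hTT₀' hJ₀ hJ₀' v (localSplittingCMWith L 2 hT₀' hT₀'d hJ₀' χ' hχ' v μ)
              (proj_localSplittingCMWith L 2 hT₀' hT₀'d hJ₀' χ' hχ' v μ))) ((MpPsi.toRep (localSchrodinger (maximalRealSubfield L) 2 T₀ v)).comp
            (scaleTransportSection (maximalRealSubfield L) L (IsCMField.complexConj L) 2 (complexConj_imagUnit L) (imagUnit_ne_zero L)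
              (imagUnit_mul_self L) T₀ T₀'' hT₀ hT₀'' (Units.mk0 T₀.det hTd)⁻¹ hTT₀'' hJ₀ hJ₀'' v (localSplittingCMWith L 2 hT₀'' hT₀''d hJ₀'' χ hχ v μ)
              (proj_localSplittingCMWith L 2 hT₀'' hT₀''d hJ₀'' χ hχ v μ))) (localCenter L (IsCMField.complexConj L) 2 J₀ J₁ hJ₁0 v) ξ (ξ.comp (localPiGalConj L (IsCMField.complexConj L) 1 v hJ₁))
    (fun g => (localPiGalConj L (IsCMField.complexConj L) 2 v hJ₀) g) (fun g => (localCongr L (IsCMField.complexConj L) (Matrix.GeneralLinearGroup.map (algebraMap (maximalRealSubfield L) L) (Matrix.GeneralLinearGroup.mkOfDetNeZero _ (det_w_mul_ne_zero hTd))⁻¹) (det_form_ne_zero L hJ₀ hTd) (formCongr_inv_w_mul (IsCMField.complexConj L) hT₀ hJ₀ hTd) v g))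
    (fun g => (((ξ (localUnitScalar L (IsCMField.complexConj L) J₁ v _ (inv_det_mul_conjLocal_inv_det L (IsCMField.complexConj L) hJ₀ v (complexConj_imagUnit L) (imagUnit_ne_zero L) hTd g)) : ℂˣ) : ℂ)))
    (commute_comp_localCenter' hJ₁0 ((MpPsi.toRep (localSchrodinger (maximalRealSubfield L) 2 T₀ v)).comp (localSplittingCMWith L 2 hT₀ hT₀d hJ₀ χ hχ v μ))) (commute_comp_localCenter' hJ₁0 ((MpPsi.toRep (localSchrodinger (maximalRealSubfield L) 2 T₀ v)).comp
            (scaleTransportSection (maximalRealSubfield L) L (IsCMField.complexConj L) 2 (complexConj_imagUnit L) (imagUnit_ne_zero L)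
              (imagUnit_mul_self L) T₀ T₀' hT₀ hT₀' (-1) hTT₀' hJ₀ hJ₀' v (localSplittingCMWith L 2 hT₀' hT₀'d hJ₀' χ' hχ' v μ)
              (proj_localSplittingCMWith L 2 hT₀' hT₀'d hJ₀' χ' hχ' v μ)))) (commute_comp_localCenter' hJ₁0 ((MpPsi.toRep (localSchrodinger (maximalRealSubfield L) 2 T₀ v)).comp
            (scaleTransportSection (maximalRealSubfield L) L (IsCMField.complexConj L) 2 (complexConj_imagUnit L) (imagUnit_ne_zero L)
              (imagUnit_mul_self L) T₀ T₀'' hT₀ hT₀'' (Units.mk0 T₀.det hTd)⁻¹ hTT₀'' hJ₀ hJ₀'' v (localSplittingCMWith L 2 hT₀'' hT₀''d hJ₀'' χ hχ v μ)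
              (proj_localSplittingCMWith L 2 hT₀'' hT₀''d hJ₀'' χ hχ v μ))))
    (exists_coinv_equiv_localPiGalConj L v μ 2 hT₁ hJ₁ hJ₁0 two_pos t hT₀t hT₀ hT₀d hT₀' hT₀'d hTT₀' hJ₀ hJ₀' hns χ χ' hχ hχ' hχχ' m hm ξ)
    (exists_coinv_equiv_localCongr_k L v μ 2 hJ₁0 two_pos t hT₀t hT₀ hT₀d hT₀'' hT₀''d ((Units.mk0 T₀.det hTd)⁻¹) hTT₀'' hJ₀ hJ₀''
      ((Matrix.GeneralLinearGroup.mkOfDetNeZero _ (det_w_mul_ne_zero hTd))⁻¹) hk₀ rfl hkJ χ hχ m hm ξ)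
    (fun g y => rep_localPiGalConj_eq_smul_rep_localCongr L (IsCMField.complexConj L) hT₀ hJ₀ hJ₁0 v (complexConj_imagUnit L) (imagUnit_ne_zero L) hTd
      ((MpPsi.toRep (localSchrodinger (maximalRealSubfield L) 2 T₀ v)).comp (localSplittingCMWith L 2 hT₀ hT₀d hJ₀ χ hχ v μ)) ξ (commute_comp_localCenter' hJ₁0 ((MpPsi.toRep (localSchrodinger (maximalRealSubfield L) 2 T₀ v)).comp (localSplittingCMWith L 2 hT₀ hT₀d hJ₀ χ hχ v μ))) g y)

end Literature.NumberTheory.GelbartRogawski1991.UnitaryDualPair.LocalSplitting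

end
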